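import Summits.CriticalPhenomena.PercolationContinuityZ3.Theorems.PercNearOneGluingNoHeavyQuantWindowPerturb
import Summits.CriticalPhenomena.PercolationContinuityZ3.Theorems.PercNearOneGluingNoHeavyQuantWindowAtomsExtreme
import HarnessLib

/-!
# QUANT lane R8, T-DEC: bookkeeping for the two-sided move inside the window polytope — the leftover mass `windowS` of a layer, the
# signed pool change `pieceG` of the pieces, the mass-zero direction `pertD`, their linearity, small multipliers, scaling a flow
# (memo WINDOW-ATOMS-G57 §2.3–2.4, file H5 part 1)

builds on p205010 (kernel theorem, internal audit signed; external expert review pending)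

Support file (`--supports stmt-CriticalPhenomena-4575`), QUANT lane seat prim-quant-census-2 (gen 57), rung R8 of
`run/shared/lean/prim/quant/LADDER.md`.  Three bookkeeping definitions (`windowS`, `pieceG`, `pertD`), theorems with standard axioms, no
sorries.  Part 2 (`…QuantWindowTwoSided`) proves the move itself (`exists_oneSided`).

* `LawDec.windowS x T j M μ J` — the leftover mass of layer `J` carried by the truncated top corner run (`Σ_l leftover_j l + Σ_{J<h≤j} F l h`).
* `LawDec.pieceG …  J` — the signed change of the pool inequality of layer `J` under the pieces (`Σ [J<hᵢ≤M] tᵢcᵢ − u[J<hᵢ]tᵢ +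
  Σ [J<gₖ≤M] sₖ − u r`, `u = x/(1−x)`).
* `LawDec.pertD … v …` — the direction `δ − (Σδ)·μ` (mass zero) of the pieces, `δ = pertLaw − μ`, `μ = vecLaw M v`.
* `pertLaw_smul`, `pieceG_smul`, `pieceG_neg`, `pertD_neg` (linearity); `eventually_nhdsGT_pos_add_mul` / `…_nonneg_add_mul` (small
  multipliers `η → 0⁺`); `flowAtT_smul` (a positive multiple of a `FlowAtT` law is `FlowAtT`); `allGiant_gap` (below a low of positive
  mass the all-giant pool inequality is strict — the flipped window layers are interior).

[this work]; nothing here is cited as a published result.  The gluing rows served [cite: KozmaNitzan2024, Conjecture 3 (p. 15)]; product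
measure [cite: Grimmett1999, §1.3 p. 10].
-/

noncomputable section

open Filter Topology

namespace Summit.CriticalPhenomena.PercolationContinuityZ3.Theorems

namespace Quant

open Finset

namespace LawDec

/-- indicator of equality of naturals, as a real number -/
local notation3 "𝟙[" a ", " b "]" => (if (a : ℕ) = (b : ℕ) then (1 : ℝ) else 0)

/-! ### Bookkeeping definitions -/

/-- **the leftover mass of layer `J` in the truncated top corner run**: `Σ_{l ≤ j, 2l<T} (leftover_j l + Σ_{J < h ≤ j} F l h)`. [this work] -/
def windowS (x T : ℝ) (j M : ℕ) (μ : ℕ → ℝ) (J : ℕ) : ℝ :=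
  ∑ l ∈ (Finset.range (j + 1)).filter (fun l : ℕ => 2 * (l : ℝ) < T),
    (cornerLeftover x T j M μ l + ∑ h ∈ Finset.range (M + 1), (if J < h ∧ h ≤ j then cornerMidFlow x T j M μ l h else 0))

/-- **the signed change of the pool inequality of layer `J`** under the pieces. [this work] -/
def pieceG (x T : ℝ) (j M : ℕ) (l₁ h₁ l₂ h₂ g₁ g₂ : ℕ) (t₁ t₂ s₁ s₂ r : ℝ) (J : ℕ) : ℝ :=
  (if J < h₁ ∧ h₁ ≤ M then t₁ * usage x T j l₁ h₁ else 0) - (if J < h₁ then x / (1 - x) * t₁ else 0)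
  + ((if J < h₂ ∧ h₂ ≤ M then t₂ * usage x T j l₂ h₂ else 0) - (if J < h₂ then x / (1 - x) * t₂ else 0))
  + (if J < g₁ ∧ g₁ ≤ M then s₁ else 0) + (if J < g₂ ∧ g₂ ≤ M then s₂ else 0) - x / (1 - x) * r

/-- **the mass-zero direction of the pieces**: `δ − (Σ δ)·μ` with `δ = pertLaw − μ`, `μ = vecLaw M v`. [this work] -/
def pertD (x T : ℝ) (j M : ℕ) (v : Fin (M + 1) → ℝ) (l₁ h₁ l₂ h₂ g₁ g₂ l₀ : ℕ) (t₁ t₂ s₁ s₂ r : ℝ) : ℕ → ℝ :=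
  fun b => (pertLaw x T j (vecLaw M v) l₁ h₁ l₂ h₂ g₁ g₂ l₀ t₁ t₂ s₁ s₂ r b - vecLaw M v b)
    - (∑ k ∈ Finset.range (M + 1), (pertLaw x T j (vecLaw M v) l₁ h₁ l₂ h₂ g₁ g₂ l₀ t₁ t₂ s₁ s₂ r k - vecLaw M v k)) * vecLaw M v b

/-! ### Linearity in the coefficients -/

section Lin

variable (x T : ℝ) (j M : ℕ) (μ : ℕ → ℝ) (l₁ h₁ l₂ h₂ g₁ g₂ l₀ : ℕ) (t₁ t₂ s₁ s₂ r : ℝ)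

/-- the pieces are linear in their coefficients. -/
theorem pertLaw_smul (η : ℝ) (b : ℕ) :
    pertLaw x T j μ l₁ h₁ l₂ h₂ g₁ g₂ l₀ (η * t₁) (η * t₂) (η * s₁) (η * s₂) (η * r) b
      = μ b + η * (pertLaw x T j μ l₁ h₁ l₂ h₂ g₁ g₂ l₀ t₁ t₂ s₁ s₂ r b - μ b) := by
  unfold pertLaw; ring

/-- the pool change is linear in the coefficients. -/
theorem pieceG_smul (η : ℝ) (J : ℕ) :
    pieceG x T j M l₁ h₁ l₂ h₂ g₁ g₂ (η * t₁) (η * t₂) (η * s₁) (η * s₂) (η * r) J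
      = η * pieceG x T j M l₁ h₁ l₂ h₂ g₁ g₂ t₁ t₂ s₁ s₂ r J := by
  unfold pieceG; split_ifs <;> ring

/-- the pool change of the negated pieces. -/
theorem pieceG_neg (J : ℕ) :
    pieceG x T j M l₁ h₁ l₂ h₂ g₁ g₂ (-t₁) (-t₂) (-s₁) (-s₂) (-r) J = - pieceG x T j M l₁ h₁ l₂ h₂ g₁ g₂ t₁ t₂ s₁ s₂ r J := by
  have := pieceG_smul x T j M l₁ h₁ l₂ h₂ g₁ g₂ t₁ t₂ s₁ s₂ r (-1) J
  simp only [neg_mul, one_mul] at this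
  exact this

/-- the direction of the negated pieces. -/
theorem pertD_neg (v : Fin (M + 1) → ℝ) (b : ℕ) :
    pertD x T j M v l₁ h₁ l₂ h₂ g₁ g₂ l₀ (-t₁) (-t₂) (-s₁) (-s₂) (-r) b = - pertD x T j M v l₁ h₁ l₂ h₂ g₁ g₂ l₀ t₁ t₂ s₁ s₂ r b := by
  have e : ∀ k, pertLaw x T j (vecLaw M v) l₁ h₁ l₂ h₂ g₁ g₂ l₀ (-t₁) (-t₂) (-s₁) (-s₂) (-r) k - vecLaw M v k
      = -(pertLaw x T j (vecLaw M v) l₁ h₁ l₂ h₂ g₁ g₂ l₀ t₁ t₂ s₁ s₂ r k - vecLaw M v k) := by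
    intro k; unfold pertLaw; ring
  unfold pertD
  simp only [e, Finset.sum_neg_distrib]
  ring

end Lin

/-! ### Small multipliers -/

/-- `b + η·k > 0` for small `η > 0` when `b > 0`. -/
theorem eventually_nhdsGT_pos_add_mul {b : ℝ} (hb : 0 < b) (k : ℝ) : ∀ᶠ η in 𝓝[>] (0:ℝ), 0 < b + η * k := by
  have ht : Tendsto (fun η : ℝ => b + η * k) (𝓝[>] (0:ℝ)) (𝓝 (b + 0 * k)) :=
    ((continuous_const.add (continuous_id.mul continuous_const)).tendsto 0).mono_left nhdsWithin_le_nhds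
  rw [zero_mul, add_zero] at ht
  exact ht.eventually (eventually_gt_nhds hb)

/-- `b + η·k ≥ 0` for small `η > 0` when `b ≥ 0` and `k = 0` if `b = 0`. -/
theorem eventually_nhdsGT_nonneg_add_mul {b k : ℝ} (hb : 0 ≤ b) (hk : b = 0 → k = 0) :
    ∀ᶠ η in 𝓝[>] (0:ℝ), 0 ≤ b + η * k := by
  rcases hb.lt_or_eq with hpos | hzero
  · exact (eventually_nhdsGT_pos_add_mul hpos k).mono fun η h => h.le
  · exact Filter.Eventually.of_forall fun η => by rw [← hzero, hk hzero.symm, mul_zero, add_zero]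

/-! ### Scaling a flow -/

/-- a positive multiple of a `FlowAtT` law is `FlowAtT` (scale the flow). [this work] -/
theorem flowAtT_smul (x T : ℝ) (J M : ℕ) (ν : ℕ → ℝ) (c : ℝ) (hc : 0 < c) (h : FlowAtT x T J M ν) :
    FlowAtT x T J M (fun b => c * ν b) := by
  obtain ⟨f, h0, hsup, hrow, hcol⟩ := h
  refine ⟨fun a b => c * f a b, fun a b => mul_nonneg hc.le (h0 a b), fun a b hp => hsup a b ?_, fun a ha hlow => ?_,
    fun b hb hself => ?_⟩
  · have hp' : c * 0 < c * f a b := by rw [mul_zero]; exact hp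
    exact lt_of_mul_lt_mul_left hp' hc.le
  · rw [← Finset.mul_sum, hrow a ha hlow]
  · have e : ∀ a, usage x T J a b * (c * f a b) = c * (usage x T J a b * f a b) := fun a => by ring
    simp only [e]
    rw [← Finset.mul_sum]
    exact mul_le_mul_of_nonneg_left (hcol b hb hself) hc.le


/-! ### The strict pool inequality below a low of positive mass -/

/-- **below a low of positive mass the all-giant inequality is strict**: if the layer `lf` (a low, `μ lf > 0`) is DEC, then at every layer
`J < lf` the pool inequality of the all-giant criterion holds with the gap `≥ (1 + u)·μ lf > 0`. [this work] -/
theorem allGiant_gap (x T : ℝ) (J lf M : ℕ) (μ : ℕ → ℝ) (hx0 : 0 < x) (hx1 : x < 1) (hμ0 : ∀ k, 0 ≤ μ k)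
    (hμM : ∀ h, M < h → μ h = 0) (hμ1 : ∑ h ∈ Finset.range (M + 1), μ h = 1)
    (hJlf : J < lf) (hlow : 2 * (lf : ℝ) < T) (hpos : 0 < μ lf) (hdec : DECAtT x T lf M μ) :
    0 < ∑ h ∈ Finset.Ico (J + 1) (M + 1), μ h
      - x / (1 - x) * ∑ l ∈ (Finset.range (J + 1)).filter (fun l : ℕ => 2 * (l : ℝ) < T), μ l := by
  have hu : 0 < x / (1 - x) := div_pos hx0 (by linarith)
  have hlfM : lf ≤ M := by
    by_contra hgt; push Not at hgt; linarith [hμM lf hgt]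
  have hno : ∀ h, h ≤ lf → T ≤ 2 * (h : ℝ) → μ h = 0 := by
    intro h hh hT; exfalso
    have : (h : ℝ) ≤ lf := by exact_mod_cast hh
    linarith
  have hineq := (decAtT_iff_of_noMid x T lf M μ hx0 hx1 hμ0 hμM hμ1 hno).1 hdec
  have hL : ∑ l ∈ (Finset.range (J + 1)).filter (fun l : ℕ => 2 * (l : ℝ) < T), μ l + μ lf
      ≤ ∑ l ∈ (Finset.range (lf + 1)).filter (fun l : ℕ => 2 * (l : ℝ) < T), μ l := by
    have hsub : (Finset.range (J + 1)).filter (fun l : ℕ => 2 * (l : ℝ) < T) ∪ {lf}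
        ⊆ (Finset.range (lf + 1)).filter (fun l : ℕ => 2 * (l : ℝ) < T) := by
      intro l hl
      rcases Finset.mem_union.1 hl with h1 | h1
      · obtain ⟨q1, q2⟩ := Finset.mem_filter.1 h1
        exact Finset.mem_filter.2 ⟨Finset.mem_range.2 (by have := Finset.mem_range.1 q1; omega), q2⟩
      · rw [Finset.mem_singleton] at h1; rw [h1]
        exact Finset.mem_filter.2 ⟨Finset.mem_range.2 (Nat.lt_succ_self _), hlow⟩
    have hdisj : Disjoint ((Finset.range (J + 1)).filter (fun l : ℕ => 2 * (l : ℝ) < T)) {lf} := by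
      rw [Finset.disjoint_singleton_right]
      intro hm
      have := Finset.mem_range.1 (Finset.mem_filter.1 hm).1
      omega
    have := Finset.sum_le_sum_of_subset_of_nonneg hsub (fun l _ _ => hμ0 l)
    rw [Finset.sum_union hdisj, Finset.sum_singleton] at this
    exact this
  have hR : ∑ h ∈ Finset.Ico (lf + 1) (M + 1), μ h + μ lf ≤ ∑ h ∈ Finset.Ico (J + 1) (M + 1), μ h := by
    have hsub : Finset.Ico (lf + 1) (M + 1) ∪ {lf} ⊆ Finset.Ico (J + 1) (M + 1) := by
      intro h hh
      rcases Finset.mem_union.1 hh with h1 | h1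
      · obtain ⟨q1, q2⟩ := Finset.mem_Ico.1 h1; exact Finset.mem_Ico.2 ⟨by omega, q2⟩
      · rw [Finset.mem_singleton] at h1; rw [h1]; exact Finset.mem_Ico.2 ⟨hJlf, Nat.lt_succ_of_le hlfM⟩
    have hdisj : Disjoint (Finset.Ico (lf + 1) (M + 1)) {lf} := by
      rw [Finset.disjoint_singleton_right]; intro hm; have := (Finset.mem_Ico.1 hm).1; omega
    have := Finset.sum_le_sum_of_subset_of_nonneg hsub (fun h _ _ => hμ0 h)
    rw [Finset.sum_union hdisj, Finset.sum_singleton] at this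
    exact this
  nlinarith [mul_pos hu hpos]

end LawDec

end Quant

end Summit.CriticalPhenomena.PercolationContinuityZ3.Theorems
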